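import Literature.MathematicalPhysics.QuantumFieldTheory.Balaban1983to89.Node00.Record13
import Literature.MathematicalPhysics.QuantumFieldTheory.Balaban1983to89.Node00.Record13SepCoPH
import Literature.MathematicalPhysics.QuantumFieldTheory.Balaban1983to89.Node00.Record13Carriers
import Literature.MathematicalPhysics.QuantumFieldTheory.Balaban1983to89.Node00.CarriersB8
import Literature.MathematicalPhysics.QuantumFieldTheory.Balaban1983to89.Node00.Record13CarriersB8SubBP2C
import Literature.MathematicalPhysics.QuantumFieldTheory.Balaban1983to89.Node00.Record13CarriersWChi  -- v11.1 (σ7): the RE-CENTRED [IV] bundle `Node00.WOfRecord₁₃Ax` (✓p801875; `WOfRecord₁₃Ax_eq` rfl)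
import Summits.QuantumFields.YangMills.Theorems.BalabanUVNodesK1EndOfNodes13PWSOfRunRemAt
import Literature.MathematicalPhysics.QuantumFieldTheory.Balaban1983to89.Node00.Record13SepCoPHV
import Summits.QuantumFields.YangMills.Theorems.BalabanUVNodesK1EndOfNodes13PWSOfRunRemAtAx
import Summits.QuantumFields.YangMills.Theorems.BalabanUVNodesN13NodeAtRevisedRecordWorldAtRecord13SepCoPHVAx
import Summits.QuantumFields.YangMills.Theorems.BalabanUVNodesN13NodeAtRevisedRecordWorldAtRecord13SepCoPHV

/-!
# K1ᴬ v11.1 — THE TREE MIRROR OF THE REGISTERED SKELETON's DEFINITIONS AND KERNEL DOORS (`K1Skeleton13SepCoPHAxV11_1.lean` 1c0150ff21ca0f8d, ✦ plan g100 OP5B′, registered on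
# stmt-QuantumFields-27239 `StabilityBRunRowsAtRecordR13SepCoPHVAx` 2026-08-31T05:52:57Z, replacing v11 54f620c18feea0f3 of 05:29:27Z — same six stub names, σ7 = ONE token `WOfRecord₁₃ ↦ WOfRecord₁₃Ax`), so that the lanes' LINE 2′ ∕ LINE 1 stub shares and per-node bills can be filed BY NAME — the K1ᴬ analogue of
# dag-n16-e's `K3AxV8Defs` (precedent, dag-lead WORDS 645); companion files `…K1AxV11Roads` (the END roads + hypothesis-form compositions) and `…K1AxV11StubTexts` (the six stub texts + the by-name concluders)

R134 seat `pub-ymgap-dag-n24-c` (g23 pen, g24 re-key to v11.1; -a hand on LINE 2′'s three stubs per `K1AX-V11-LINE-TABLE.md` v3), `--kind definition --supports stmt-QuantumFields-27239 --as helper`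
(count-neutral; nothing registered — the plan keeps the registered skeleton; on any v12 re-cut this mirror is superseded, not edited).  THIS FILE = the registered skeleton's lines :187–:232, :237–:259,
:295–:343, :382–:502, :527–:543 VERBATIM (namespace `…Theses.BalabanUVNodes.K1Skeleton13SepCoPHAxV11` ↦ `…Theorems.K1AxV11Defs`; its imports minus the route file; every `def` ∕ `abbrev` ∕ `theorem` and
every docstring byte-identical; the three `sorry` stubs of each line and the two by-name concluders are NOT here — they are the registered kit's; the stub TEXTS are `…K1AxV11StubTexts`): `SU2`, `RecordS`,
`endStatementBPrinted_of_recordS_of_nodes`, `Inhabited13`, `NodesAtSomeRecord13PWS`, `Window`, `BetaWindowAtSomeRecord13S`, `RunRowsAtSomeRecord13PWS`, `RunRowsContAtSomeRecord13PWS`, `Cont13All`,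
`stubCont13_of_cont13All`, `RecordSV`, `recordSV_refl_iff`, `recordS_rebound_of_recordSV`, `NodesAtSomeRecord13PWSV`, `RunRowsAtSomeRecord13PWSV`, `RunRowsContAtSomeRecord13PWSV`, the three
`…V_of_line1` doors, `RecordSVC`, `NodesAtSomeRecord13PWSVW`, `RunRowsAtSomeRecord13PWSVW`, `RunRowsContAtSomeRecord13PWSVW`, the three `…VW_of_V` doors, `nodesAtSomeRecord13PWSVW_of_line1`,
`stubCont13VW_of_cont13All`.  NOT Theses-free: `RunConstRemainder ∕ SurvCont` (`…K2NamedJetsRunRemAt`) and the END road Ax (`…K1EndOfNodes13PWSOfRunRemAtAx`) live in the route's cone already.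

HONEST FRAMING.  Definitions mirrored from the registered kit + their own kernel doors; no estimate; nothing of Bałaban asserted or instantiated; no stub of K1ᴬ v11 proved or claimed; K1ᴬ OPEN
(v11 0∕6, never summed across lines); counts UNMOVED (typed 28∕28 · discharged 8∕27, A 8∕28).  One finite 𝕋⁴ programme at fixed `ε` — NOT continuum ∕ ℝ⁴ ∕ OS ∕ mass gap ∕ Clay.  No `sorry`,
`instance`, `notation`; standard axioms.  The skeleton's own header (history v1–v11) is not repeated here; its docstrings below are VERBATIM — with ONE lexical exception: in the docstring of
the parameterless supplier letter `Cont13All` the kit's `[cite: …]` tag is spelled in prose (same locator), because a `[cite:]`-tagged parameterless `def … : Prop` under Theorems∕ is RELOCATED by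
the gate to Literature∕ as a named fact (p812605∕p812606 bounced that way) — `Cont13All` is a skeleton-local letter over tree definitions, not a published result.
-/

set_option autoImplicit false

noncomputable section

namespace Summit.QuantumFields.YangMills.Theorems.K1AxV11Defs

open Literature.MathematicalPhysics.QuantumFieldTheory.Balaban1983to89
open Literature.MathematicalPhysics.QuantumFieldTheory.Balaban1983to89.T4Continuum
open Literature.MathematicalPhysics.QuantumFieldTheory.Balaban1983to89.DagBinding

/-- the group of record -/
abbrev SU2 := Matrix.specialUnitaryGroup (Fin 2) ℂ

/-- **THE S-BOUND RECORD CLASS AT THE PRESENTING PAIR** (skeleton-local; tree twin WANTED as `Node00.IsRecordOfRecord₁₃CSepCoPHS`): def-T's `IsRecordOfRecord₁₃CSepCoPH` with `upOfRecord₅C ↦ upOfRecord₅CS`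
— SOME admissible separated-range parameter `θ'` presenting the SAME datum, the world bound to its construction, window `0 < w.γ ≤ θ'.γ`, block size, and the S-BINDING of record over its Stage-13 view. -/
def RecordS (F : T4Family) (θ : Node00.Stage13HParams F 2) (h : θ.Provisos₁₃SepCoPHAx F 2) (w : WorldP) : Prop :=
  ∃ (θ' : Node00.Stage13HParams F 2) (h' : θ'.Provisos₁₃SepCoPHAx F 2), θ'.Admissible F 2 ∧
    Node00.datumOfRecord₁₃SepCoPHAx F 2 θ h = Node00.datumOfRecord₁₃SepCoPHAx F 2 θ' h' ∧ w.C = (Node00.datumOfRecord₁₃SepCoPHAx F 2 θ h).C ∧ (0 < w.γ ∧ w.γ ≤ θ'.γ) ∧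
    w.L = (θ'.L : ℝ) ∧ ∀ P : B12.RunParams, w.up P = Node00.upOfRecord₅CS F 2 (θ'.toStage5₁₃CoPHChi F 2 (Node00.chiβOfRecord₁₃Ax F 2 θ'.toStage13Params)) P

/-- **END FROM NODES AT AN S-BOUND WORLD** (world-level headline; the (0.20) guard from the C-companion): nodes at every run + β bounds in the window ⇒ (B) at the datum of record. -/
theorem endStatementBPrinted_of_recordS_of_nodes {F : T4Family} {θ : Node00.Stage13HParams F 2} {h : θ.Provisos₁₃SepCoPHAx F 2} {w : WorldP} (hR : RecordS F θ h w)
    (hnodes : ∀ P, Nodes (leavesP w P)) (hβ : BetaBoundsInInterval w.C.toB12 w.γ w.b w.βup) :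
    B16.EndStatementBPrinted (Node00.datumOfRecord₁₃SepCoPHAx F 2 θ h).C :=
  -- v11 (op 5b): `RecordS F θ h w` IS membership in the Ax S-class (`Node00.recordS₁₃SepCoPHAx_iff`, `Iff.rfl`); END from nodes at any Ax-S-class record (`Node00/Record13SClassSepCoPHChiCmap`).
  Node00.endStatementBPrinted_of_isRecordOfRecord₁₃CSepCoPHSAx_of_nodes ((Node00.recordS₁₃SepCoPHAx_iff θ h w).1 hR) le_rfl hnodes hβ

/-- rung 0 (K0′'s conclusion on `F`, θ-keyed per director LINE №99 (2)): an admissible Stage-13 tuple with provisos and print's partition of unity. -/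
def Inhabited13 (F : T4Family) : Prop :=
  ∃ θ : Node00.Stage13HParams F 2, θ.Provisos₁₃SepCoPHAx F 2 ∧ (θ.ZhUnity F 2 ∧ θ.SlotsNondegenerate₁₃Ax F 2) ∧ θ.Admissible F 2

/-- rung 1 (v3.1: S-BOUND world; v3: N08 AND N12 PINNED BY NAME): SOME unity Stage-13 tuple and an S-BOUND world of its datum of record (`RecordS`; e.g. the four-pin X-H engine world, probe (b)) all of whose
runs' leaf worlds satisfy the thirteen DAG nodes, AND print's [B10] sentence `Node00.PrintedUV3V 2 θ.L` ([Balaban1985UV3] Thm 1 p.257 (compact) + Thm 2 p.272 with their printed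
∃-prefix; def-T `Node00/CarriersB10.lean` :125 — v2, referee dag-ref-C READ185 AUDIT A2), AND (v3, referee dag-ref-F READ-267) on every run that has steps the `rBasicStep` leaf the DAG reads
IS [Balaban1989LargeFieldI]'s basic step `B15Leaf` ((0.4)–(0.6) p.176, Prop. 1 (1.78) p.194, (1.80) p.195, (1.89) p.198, (1.102) p.201) at NODE 00's bundle of record `Node00.WOfRecord₁₃Ax F 2 θ.toStage13Params λ P`
read at a genuine step `λ.kSel P < P.K` — so that no witness serving N08 by an empty [B10] run family or N12 by a degenerate [IV] bundle closes this rung with the node unmeasured. -/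
def NodesAtSomeRecord13PWS (F : T4Family) : Prop :=
  ∃ (θ : Node00.Stage13HParams F 2) (h : θ.Provisos₁₃SepCoPHAx F 2) (w : WorldP), (θ.ZhUnity F 2 ∧ θ.SlotsNondegenerate₁₃Ax F 2) ∧ θ.Admissible F 2 ∧
    RecordS F θ h w ∧ (∀ P : B12.RunParams, Nodes (leavesP w P)) ∧ Node00.PrintedUV3V 2 θ.L ∧
    ∃ lam : Node00.ResidW F 2, (∀ P : B12.RunParams, 1 ≤ P.K → lam.kSel P < P.K) ∧
      ∀ P : B12.RunParams, lam.kSel P < P.K → ((leavesP w P).rBasicStep ↔ B15Leaf (Node00.WOfRecord₁₃Ax F 2 θ.toStage13Params lam P))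

/-- the non-vacuity window of the crux (a clause about `D.C` only). -/
def Window {F : T4Family} (D : FiniteEpsData F SU2) : Prop :=
  ∃ γ₁ : ℝ, 0 < γ₁ ∧ ∀ γ : ℝ, 0 < γ → γ ≤ γ₁ → ∃ P : B12.RunParams, 1 ≤ P.K ∧ (D.C P).flow.InInterval γ P.K

/-- rung 2: SOME unity Stage-13 tuple and world with all nodes, the β bounds in the interval at `γ₀ := w.γ`, and the window at the datum of record. -/
def BetaWindowAtSomeRecord13S (F : T4Family) : Prop :=
  ∃ (θ : Node00.Stage13HParams F 2) (h : θ.Provisos₁₃SepCoPHAx F 2) (w : WorldP), (θ.ZhUnity F 2 ∧ θ.SlotsNondegenerate₁₃Ax F 2) ∧ θ.Admissible F 2 ∧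
    RecordS F θ h w ∧ (∀ P : B12.RunParams, Nodes (leavesP w P)) ∧
    BetaBoundsInInterval w.C.toB12 w.γ w.b w.βup ∧ Window (Node00.datumOfRecord₁₃SepCoPHAx F 2 θ h)

section RunRows

open FlowStepRuns
open FlowStep (HBeta RGEqH prefixOf)
open Summit.QuantumFields.YangMills.Theorems.BalabanUVNodesK2NamedJetsRunRemAt (RunConstRemainder)
open Summit.QuantumFields.YangMills.BalabanUVNodes.K1EndOfNodes13PWSOfRunRemAtAx (stabilityB_body_of_rung1At_of_runLetters_Ax)  -- v11 (op 5b): (ii) the Ax END road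

/-- rung 2″ (v6, RUN CURRENCY): SOME unity Stage-13 tuple `θ` with provisos, an S-bound world `w` of its datum of record with the thirteen DAG nodes at every run (the rung-1 data — a prover
may keep stub 1's witness or re-choose it), AND the RUN ROWS of `β_θ := Node00.betaOfRecord₁₃Ax F 2 θ.toStage13Params` (= the datum's `βfun`, `Node00.βfun_datumOfRecord₁₃SepCoPHAx`, `rfl`) that
the END road of record reads: on SOME level `γ₀ > 0` — (i) DEF-1's RUN-WISE CONSTANT REMAINDER `RunConstRemainder β_θ b r γ₀` relative to SOME reference sequence `b` ([I] Thm 3 p.264 with (1.22):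
β read along `0 < g_k ≤ γ`; (5.10) p.293; [II] (2.41) p.21), (ii) a bound `∀ k, b k ≤ B`, (iii) the numeric CEILING MATCH `B + r ≤ w.βup` (N11's `flowControl` reads `w.βup`), (iv) the RUN-WISE
PARTIAL-SUM FLOOR `−M` along every solution of (0.20) up to `n` staying in `]0, γ₀]` (DEF-1's (PS) shape; the AF-sign content, lower half of T09.F).  `b r γ₀ B M` free (∃-side, №204).
NO box letter; NO named-jet letter; the window is derived, not asked. -/
def RunRowsAtSomeRecord13PWS (F : T4Family) : Prop :=
  ∃ (θ : Node00.Stage13HParams F 2) (h : θ.Provisos₁₃SepCoPHAx F 2) (w : WorldP), (θ.ZhUnity F 2 ∧ θ.SlotsNondegenerate₁₃Ax F 2) ∧ θ.Admissible F 2 ∧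
    RecordS F θ h w ∧ (∀ P : B12.RunParams, Nodes (leavesP w P)) ∧
    ∃ (b : ℕ → ℝ) (r γ₀ B M : ℝ), 0 < γ₀ ∧ RunConstRemainder (Node00.betaOfRecord₁₃Ax F 2 θ.toStage13Params) b r γ₀ ∧ (∀ k, b k ≤ B) ∧ B + r ≤ w.βup ∧
      ∀ (n : ℕ) (gs : ℕ → ℝ), RGEqH n (Node00.betaOfRecord₁₃Ax F 2 θ.toStage13Params) gs → Step.InInterval γ₀ n gs →
        ∀ k, k ≤ n → -M ≤ ∑ j ∈ Finset.Ico k n, Node00.betaOfRecord₁₃Ax F 2 θ.toStage13Params j (prefixOf gs j)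

open Summit.QuantumFields.YangMills.Theorems.BalabanUVNodesK2NamedJetsRunRemAt (SurvCont)

/-- **rung 2‴ (v7ᴿ ed.2, RUN CURRENCY + (C); = ym-nodeO IDEA-4 g12 `RunRowsContAtSomeRecord13PWS` VERBATIM)**: rung 2″'s text (`RunRowsAtSomeRecord13PWS F`, v6, byte-identical
above) with ONE more conjunct — (C) run-wise SURVIVOR CONTINUITY `SurvCont β_θ γ₀` of `β_θ := Node00.betaOfRecord₁₃Ax F 2 θ.toStage13Params` AT THE SAME witness `(θ, h, w)` and THE SAME
level `γ₀` as the rows (i)–(iv) ([I] §1 pp.263–264: continuity of the effective-action coefficients in the couplings — asserted in print without proof; the record's β is the second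
moment of a `limUnder`-valued kernel `Node00.polLimit`, so continuity in the history is NOT by construction).  `b r γ₀ B M` free (∃-side). [cite: Balaban1987RG1, Thm 3 p.264,
(1.20)–(1.22) p.264, (5.10) p.293, §1 pp.263–264; Balaban1988RG2Cluster, (2.41) p.21 (statement shape only)] -/
def RunRowsContAtSomeRecord13PWS (F : T4Family) : Prop :=
  ∃ (θ : Node00.Stage13HParams F 2) (h : θ.Provisos₁₃SepCoPHAx F 2) (w : WorldP), (θ.ZhUnity F 2 ∧ θ.SlotsNondegenerate₁₃Ax F 2) ∧ θ.Admissible F 2 ∧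
    RecordS F θ h w ∧ (∀ P : B12.RunParams, Nodes (leavesP w P)) ∧
    ∃ (b : ℕ → ℝ) (r γ₀ B M : ℝ), 0 < γ₀ ∧ RunConstRemainder (Node00.betaOfRecord₁₃Ax F 2 θ.toStage13Params) b r γ₀ ∧ (∀ k, b k ≤ B) ∧ B + r ≤ w.βup ∧
      (∀ (n : ℕ) (gs : ℕ → ℝ), RGEqH n (Node00.betaOfRecord₁₃Ax F 2 θ.toStage13Params) gs → Step.InInterval γ₀ n gs →
        ∀ k, k ≤ n → -M ≤ ∑ j ∈ Finset.Ico k n, Node00.betaOfRecord₁₃Ax F 2 θ.toStage13Params j (prefixOf gs j)) ∧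
      SurvCont (Node00.betaOfRecord₁₃Ax F 2 θ.toStage13Params) γ₀

/-- **THE ∀θ (C) LETTER `Cont13All`** (a SUPPLIER letter, NOT a stub; = Sketch26R `Cont13All` VERBATIM, the shape named in WORDS-2 l.31272): run-wise survivor continuity of the record's β
at EVERY admissible Stage-13 tuple with provisos and EVERY level `0 < γ₀ ≤ θ.γ`.  STRONGER than stub 3 (`stubCont13_of_cont13All`); true only if (C) holds at every admissible tuple,
whereas K1⁸ needs it at ONE — hence not the registered text (IDEA-4 g12 F-B). (Balaban1987RG1, §1 pp.263–264 — statement shape only; bookkeeping) -/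
def Cont13All : Prop :=
  ∀ (F : T4Family) (θ : Node00.Stage13HParams F 2), θ.Provisos₁₃SepCoPHAx F 2 → θ.Admissible F 2 →
    ∀ γ₀ : ℝ, 0 < γ₀ → γ₀ ≤ θ.γ → SurvCont (Node00.betaOfRecord₁₃Ax F 2 θ.toStage13Params) γ₀

/-- **`Cont13All` ⟹ STUB 3's TEXT** (kernel; = IDEA-4 g12 `stubCont13_of_cont13All`): at a rows witness `(θ, h, w)` read (C) at the admissible PRESENTING tuple `θ'` of `RecordS` (same datum ⟹
same β of record, `Node00.βfun_datumOfRecord₁₃SepCoPHAx`) at the level `min γ₀ w.γ ≤ θ'.γ`, and cut the rows to that level (`RunConstRemainder.mono`; the floor is antitone in the level). -/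
theorem stubCont13_of_cont13All (hC : Cont13All) : ∀ F : T4Family, RunRowsAtSomeRecord13PWS F → RunRowsContAtSomeRecord13PWS F := by
  intro F hrows
  obtain ⟨θ, h, w, hU, hθ, hR, hnodes, b, r, γ₀, B, M, hγ₀, hrem, hB, hmatch, hps⟩ := hrows
  obtain ⟨θ', h', hθ'adm, hD, hC', ⟨hwγ, hwγle⟩, hL, hup⟩ := hR
  have hγ₁ : 0 < min γ₀ w.γ := lt_min hγ₀ hwγ
  have hγ₁le : min γ₀ w.γ ≤ θ'.γ := (min_le_right _ _).trans hwγle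
  have hβ : Node00.betaOfRecord₁₃Ax F 2 θ'.toStage13Params = Node00.betaOfRecord₁₃Ax F 2 θ.toStage13Params := by
    rw [← Node00.βfun_datumOfRecord₁₃SepCoPHAx (θ := θ') (h := h'), ← Node00.βfun_datumOfRecord₁₃SepCoPHAx (θ := θ) (h := h), hD]
  have hsc : SurvCont (Node00.betaOfRecord₁₃Ax F 2 θ.toStage13Params) (min γ₀ w.γ) := by
    have := hC F θ' h' hθ'adm (min γ₀ w.γ) hγ₁ hγ₁le
    rwa [hβ] at this
  refine ⟨θ, h, w, hU, hθ, ⟨θ', h', hθ'adm, hD, hC', ⟨hwγ, hwγle⟩, hL, hup⟩, hnodes, b, r, min γ₀ w.γ, B, M, hγ₁, hrem.mono (min_le_left _ _), hB, hmatch, ?_, hsc⟩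
  intro n gs hrg hI k hk
  exact hps n gs hrg (fun j hj => ⟨(hI j hj).1, (hI j hj).2.trans (min_le_left _ _)⟩) k hk

/-! ### LINE 2 ∕ LINE 2′ — the slot class, the V ∕ VW rungs and their doors (registered kit :380–:496) -/

/-- **THE S-BOUND RECORD CLASS AT THE SLOT `RecordSⱽ`** (dag-n13-w1 g5 LOCATED-2, INBOX l.36098: the version pin's carrier in LINE 1 is `RecordS`'s clause `w.C = (datumOfRecord₁₃SepCoPHAx …).C`;
the re-target keys the world's construction at the slot): `RecordS F θ h w` (above, :127) BYTE-KEPT except that ONE clause, which binds the world to the REVISED record datum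
`Node00.datumOfRecord₁₃SepCoPHVAx F 2 θ h v` (DEF-1 p620607; faces `datumOfRecord₁₃SepCoPHV_C_eq_update` ∕ `toB12_…` ∕ `βfun_…` ∕ `flow_…` all `rfl`).  [cite: Balaban1989LargeFieldII, Thm 1 + (0.1) pp.355–356;
Balaban1988Convergent, (0.2) p.244, (2.18) p.257 (bookkeeping)] -/
def RecordSV (F : T4Family) (θ : Node00.Stage13HParams F 2) (h : θ.Provisos₁₃SepCoPHAx F 2) (v : Node00.Revision₁₃Ax F 2 θ h) (w : WorldP) : Prop :=
  ∃ (θ' : Node00.Stage13HParams F 2) (h' : θ'.Provisos₁₃SepCoPHAx F 2), θ'.Admissible F 2 ∧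
    Node00.datumOfRecord₁₃SepCoPHAx F 2 θ h = Node00.datumOfRecord₁₃SepCoPHAx F 2 θ' h' ∧ w.C = (Node00.datumOfRecord₁₃SepCoPHVAx F 2 θ h v).C ∧ (0 < w.γ ∧ w.γ ≤ θ'.γ) ∧
    w.L = (θ'.L : ℝ) ∧ ∀ P : B12.RunParams, w.up P = Node00.upOfRecord₅CS F 2 (θ'.toStage5₁₃CoPHChi F 2 (Node00.chiβOfRecord₁₃Ax F 2 θ'.toStage13Params)) P

/-- **THE DOOR** (definitional, through `Node00.datumOfRecord₁₃SepCoPHVAx_refl` = `rfl`): at the trivial revision the slot class IS LINE 1's `RecordS`. -/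
theorem recordSV_refl_iff {F : T4Family} (θ : Node00.Stage13HParams F 2) (h : θ.Provisos₁₃SepCoPHAx F 2) (w : WorldP) :
    RecordSV F θ h (Node00.Revision₁₃Ax.refl F 2 θ h) w ↔ RecordS F θ h w := Iff.rfl

/-- **THE RECORD-REBOUND TWIN**: an `RecordSⱽ` world with its construction re-bound to the datum of record is an `RecordS` world (every other letter unchanged) — the carrier of the (0.20) guard. -/
theorem recordS_rebound_of_recordSV {F : T4Family} {θ : Node00.Stage13HParams F 2} {h : θ.Provisos₁₃SepCoPHAx F 2} {v : Node00.Revision₁₃Ax F 2 θ h} {w : WorldP}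
    (hR : RecordSV F θ h v w) : RecordS F θ h { w with C := (Node00.datumOfRecord₁₃SepCoPHAx F 2 θ h).C } := by
  obtain ⟨θ', h', hθ', hD, -, hγ, hL, hup⟩ := hR
  exact ⟨θ', h', hθ', hD, rfl, hγ, hL, hup⟩

/-- rung 1ⱽ (LINE 2) = LINE 1's rung 1 `NodesAtSomeRecord13PWS` with the witness tuple `(θ, h, v, w)` and the world in the slot class `RecordSⱽ F θ h v w`: the thirteen DAG nodes at every run of a world
bound to SOME REVISED record datum — N13's `uvBounds` leaf then reads [III] (2.50) POINTWISE on the re-chosen densities `v.ρ` (n13-w3 g4 `uvBounds_iff_revision₁₃`), every other leaf is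
version-blind (`leavesP_revision₁₃_eq_update`); N08 pinned by name; [IV]'s basic step at the bundle of record (byte-kept).
[cite: Balaban1989LargeFieldII, Thm 1 p.355, (0.1) pp.355–356; Balaban1988Convergent, Cor. 3 (2.50) p.264, (0.2) p.244; Balaban1985UV3, Thm 1 p.257, Thm 2 p.272; Balaban1989LargeFieldI, (0.4)–(0.6) p.176 (statement shapes)] -/
def NodesAtSomeRecord13PWSV (F : T4Family) : Prop :=
  ∃ (θ : Node00.Stage13HParams F 2) (h : θ.Provisos₁₃SepCoPHAx F 2) (v : Node00.Revision₁₃Ax F 2 θ h) (w : WorldP), (θ.ZhUnity F 2 ∧ θ.SlotsNondegenerate₁₃Ax F 2) ∧ θ.Admissible F 2 ∧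
    RecordSV F θ h v w ∧ (∀ P : B12.RunParams, Nodes (leavesP w P)) ∧ Node00.PrintedUV3V 2 θ.L ∧
    ∃ lam : Node00.ResidW F 2, (∀ P : B12.RunParams, 1 ≤ P.K → lam.kSel P < P.K) ∧
      ∀ P : B12.RunParams, lam.kSel P < P.K → ((leavesP w P).rBasicStep ↔ B15Leaf (Node00.WOfRecord₁₃Ax F 2 θ.toStage13Params lam P))

/-- rung 2ⱽ (LINE 2) = LINE 1's rung 2″ `RunRowsAtSomeRecord13PWS` over the slot class: the rung-1ⱽ data AND the run rows (i)–(iv) of `β_θ` on some level `γ₀ > 0` (θ-level, version-free: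
`Node00.βfun_datumOfRecord₁₃SepCoPHVAx` = `rfl`). [cite: Balaban1987RG1, Thm 3 p.264, (1.22) p.264, (5.10) p.293; Balaban1988RG2Cluster, (2.41) p.21 (statement shapes)] -/
def RunRowsAtSomeRecord13PWSV (F : T4Family) : Prop :=
  ∃ (θ : Node00.Stage13HParams F 2) (h : θ.Provisos₁₃SepCoPHAx F 2) (v : Node00.Revision₁₃Ax F 2 θ h) (w : WorldP), (θ.ZhUnity F 2 ∧ θ.SlotsNondegenerate₁₃Ax F 2) ∧ θ.Admissible F 2 ∧
    RecordSV F θ h v w ∧ (∀ P : B12.RunParams, Nodes (leavesP w P)) ∧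
    ∃ (b : ℕ → ℝ) (r γ₀ B M : ℝ), 0 < γ₀ ∧ RunConstRemainder (Node00.betaOfRecord₁₃Ax F 2 θ.toStage13Params) b r γ₀ ∧ (∀ k, b k ≤ B) ∧ B + r ≤ w.βup ∧
      ∀ (n : ℕ) (gs : ℕ → ℝ), RGEqH n (Node00.betaOfRecord₁₃Ax F 2 θ.toStage13Params) gs → Step.InInterval γ₀ n gs →
        ∀ k, k ≤ n → -M ≤ ∑ j ∈ Finset.Ico k n, Node00.betaOfRecord₁₃Ax F 2 θ.toStage13Params j (prefixOf gs j)

/-- rung 2ⱽ‴ (LINE 2) = LINE 1's rung 2‴ `RunRowsContAtSomeRecord13PWS` over the slot class: rung 2ⱽ AND (C) run-wise survivor continuity of `β_θ` at the same level.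
[cite: Balaban1987RG1, §1 pp.263–264 (statement shape only)] -/
def RunRowsContAtSomeRecord13PWSV (F : T4Family) : Prop :=
  ∃ (θ : Node00.Stage13HParams F 2) (h : θ.Provisos₁₃SepCoPHAx F 2) (v : Node00.Revision₁₃Ax F 2 θ h) (w : WorldP), (θ.ZhUnity F 2 ∧ θ.SlotsNondegenerate₁₃Ax F 2) ∧ θ.Admissible F 2 ∧
    RecordSV F θ h v w ∧ (∀ P : B12.RunParams, Nodes (leavesP w P)) ∧
    ∃ (b : ℕ → ℝ) (r γ₀ B M : ℝ), 0 < γ₀ ∧ RunConstRemainder (Node00.betaOfRecord₁₃Ax F 2 θ.toStage13Params) b r γ₀ ∧ (∀ k, b k ≤ B) ∧ B + r ≤ w.βup ∧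
      (∀ (n : ℕ) (gs : ℕ → ℝ), RGEqH n (Node00.betaOfRecord₁₃Ax F 2 θ.toStage13Params) gs → Step.InInterval γ₀ n gs →
        ∀ k, k ≤ n → -M ≤ ∑ j ∈ Finset.Ico k n, Node00.betaOfRecord₁₃Ax F 2 θ.toStage13Params j (prefixOf gs j)) ∧
      SurvCont (Node00.betaOfRecord₁₃Ax F 2 θ.toStage13Params) γ₀

/-- LINE 1 ⟹ LINE 2 at rung 1 (kernel, through the `refl` door): every LINE-1 rung-1 result feeds LINE 2. -/
theorem nodesAtSomeRecord13PWSV_of_line1 {F : T4Family} (hN : NodesAtSomeRecord13PWS F) : NodesAtSomeRecord13PWSV F := by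
  obtain ⟨θ, h, w, hU, hθ, hR, hnodes, h08, lam, hsel, hstep⟩ := hN
  exact ⟨θ, h, Node00.Revision₁₃Ax.refl F 2 θ h, w, hU, hθ, (recordSV_refl_iff θ h w).2 hR, hnodes, h08, lam, hsel, hstep⟩

/-- LINE 1 ⟹ LINE 2 at rung 2 (kernel, `refl` door). -/
theorem runRowsAtSomeRecord13PWSV_of_line1 {F : T4Family} (hN : RunRowsAtSomeRecord13PWS F) : RunRowsAtSomeRecord13PWSV F := by
  obtain ⟨θ, h, w, hU, hθ, hR, hnodes, b, r, γ₀, B, M, hγ₀, hrem, hB, hmatch, hps⟩ := hN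
  exact ⟨θ, h, Node00.Revision₁₃Ax.refl F 2 θ h, w, hU, hθ, (recordSV_refl_iff θ h w).2 hR, hnodes, b, r, γ₀, B, M, hγ₀, hrem, hB, hmatch, hps⟩

/-- LINE 1 ⟹ LINE 2 at rung 2‴ (kernel, `refl` door). -/
theorem runRowsContAtSomeRecord13PWSV_of_line1 {F : T4Family} (hN : RunRowsContAtSomeRecord13PWS F) : RunRowsContAtSomeRecord13PWSV F := by
  obtain ⟨θ, h, w, hU, hθ, hR, hnodes, b, r, γ₀, B, M, hγ₀, hrem, hB, hmatch, hps, hsc⟩ := hN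
  exact ⟨θ, h, Node00.Revision₁₃Ax.refl F 2 θ h, w, hU, hθ, (recordSV_refl_iff θ h w).2 hR, hnodes, b, r, γ₀, B, M, hγ₀, hrem, hB, hmatch, hps, hsc⟩

/-- **[B8] DISPLAY ALTERNATIVE (FLAG №4 candidate; TYPED PROBE ONLY — no rung reads it)**: `RecordSⱽ` with the world's carriers bound to the REPAIRED-constant installer
`upOfRecord₅CSC … (c₇OfRecord …)` (P₂C, dag-n05-d) instead of print's surviving-form leaf `B8LeafRS` (`upOfRecord₅CS`).  dag-n24-c g11 LOCATED-RUNG1-B8RS option (α); enters a rung ONLY on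
director-ym's FLAG №4 ruling. [cite: Balaban1985RegularSpaces, Prop. 7 p.97, Thm 8 p.101 (bookkeeping)] -/
def RecordSVC (F : T4Family) (θ : Node00.Stage13HParams F 2) (h : θ.Provisos₁₃SepCoPHAx F 2) (v : Node00.Revision₁₃Ax F 2 θ h) (w : WorldP) : Prop :=
  ∃ (θ' : Node00.Stage13HParams F 2) (h' : θ'.Provisos₁₃SepCoPHAx F 2), θ'.Admissible F 2 ∧
    Node00.datumOfRecord₁₃SepCoPHAx F 2 θ h = Node00.datumOfRecord₁₃SepCoPHAx F 2 θ' h' ∧ w.C = (Node00.datumOfRecord₁₃SepCoPHVAx F 2 θ h v).C ∧ (0 < w.γ ∧ w.γ ≤ θ'.γ) ∧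
    w.L = (θ'.L : ℝ) ∧ ∀ P : B12.RunParams, w.up P = Node00.upOfRecord₅CSC F 2 (θ'.toStage5₁₃CoPHChi F 2 (Node00.chiβOfRecord₁₃Ax F 2 θ'.toStage13Params)) (Node00.c₇OfRecord (θ'.toStage5₁₃CoPHChi F 2 (Node00.chiβOfRecord₁₃Ax F 2 θ'.toStage13Params)).toStage3Params) P

/-! ### §R9W — LINE 2′ (R1W draft): the WINDOW-GUARDED rungs over the slot class -/

/-- rung 1ⱽᵂ (LINE 2′) = rung 1ⱽ with the thirteen nodes AND the [IV]-pin asked only on runs inside the world's coupling window `(leavesP w P).smallCouplings`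
(dag-n24-c g11 LOCATED-RUNG1-PIN option (α)); every other conjunct byte-identical to `NodesAtSomeRecord13PWSV`.
[cite: Balaban1989LargeFieldII, Thm 1 p.355 + (0.1) pp.355–356; Balaban1989LargeFieldI, (1.2) p.178, Prop. 1 p.194 (statement shapes; bookkeeping)] -/
def NodesAtSomeRecord13PWSVW (F : T4Family) : Prop :=
  ∃ (θ : Node00.Stage13HParams F 2) (h : θ.Provisos₁₃SepCoPHAx F 2) (v : Node00.Revision₁₃Ax F 2 θ h) (w : WorldP), (θ.ZhUnity F 2 ∧ θ.SlotsNondegenerate₁₃Ax F 2) ∧ θ.Admissible F 2 ∧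
    RecordSV F θ h v w ∧ (∀ P : B12.RunParams, (leavesP w P).smallCouplings → Nodes (leavesP w P)) ∧ Node00.PrintedUV3V 2 θ.L ∧
    ∃ lam : Node00.ResidW F 2, (∀ P : B12.RunParams, 1 ≤ P.K → lam.kSel P < P.K) ∧
      ∀ P : B12.RunParams, lam.kSel P < P.K → (leavesP w P).smallCouplings → ((leavesP w P).rBasicStep ↔ B15Leaf (Node00.WOfRecord₁₃Ax F 2 θ.toStage13Params lam P))

/-- rung 2ⱽᵂ (LINE 2′) = rung 2ⱽ with the nodes window-guarded; the run rows (i)–(iv) unchanged (θ-level). [cite: Balaban1987RG1, Thm 3 p.264, (1.22) p.264, (5.10) p.293 (statement shapes)] -/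
def RunRowsAtSomeRecord13PWSVW (F : T4Family) : Prop :=
  ∃ (θ : Node00.Stage13HParams F 2) (h : θ.Provisos₁₃SepCoPHAx F 2) (v : Node00.Revision₁₃Ax F 2 θ h) (w : WorldP), (θ.ZhUnity F 2 ∧ θ.SlotsNondegenerate₁₃Ax F 2) ∧ θ.Admissible F 2 ∧
    RecordSV F θ h v w ∧ (∀ P : B12.RunParams, (leavesP w P).smallCouplings → Nodes (leavesP w P)) ∧
    ∃ (b : ℕ → ℝ) (r γ₀ B M : ℝ), 0 < γ₀ ∧ RunConstRemainder (Node00.betaOfRecord₁₃Ax F 2 θ.toStage13Params) b r γ₀ ∧ (∀ k, b k ≤ B) ∧ B + r ≤ w.βup ∧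
      ∀ (n : ℕ) (gs : ℕ → ℝ), RGEqH n (Node00.betaOfRecord₁₃Ax F 2 θ.toStage13Params) gs → Step.InInterval γ₀ n gs →
        ∀ k, k ≤ n → -M ≤ ∑ j ∈ Finset.Ico k n, Node00.betaOfRecord₁₃Ax F 2 θ.toStage13Params j (prefixOf gs j)

/-- rung 2ⱽᵂ‴ (LINE 2′) = rung 2ⱽ‴ with the nodes window-guarded; rows + (C) unchanged. [cite: Balaban1987RG1, §1 pp.263–264 (statement shape only)] -/
def RunRowsContAtSomeRecord13PWSVW (F : T4Family) : Prop :=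
  ∃ (θ : Node00.Stage13HParams F 2) (h : θ.Provisos₁₃SepCoPHAx F 2) (v : Node00.Revision₁₃Ax F 2 θ h) (w : WorldP), (θ.ZhUnity F 2 ∧ θ.SlotsNondegenerate₁₃Ax F 2) ∧ θ.Admissible F 2 ∧
    RecordSV F θ h v w ∧ (∀ P : B12.RunParams, (leavesP w P).smallCouplings → Nodes (leavesP w P)) ∧
    ∃ (b : ℕ → ℝ) (r γ₀ B M : ℝ), 0 < γ₀ ∧ RunConstRemainder (Node00.betaOfRecord₁₃Ax F 2 θ.toStage13Params) b r γ₀ ∧ (∀ k, b k ≤ B) ∧ B + r ≤ w.βup ∧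
      (∀ (n : ℕ) (gs : ℕ → ℝ), RGEqH n (Node00.betaOfRecord₁₃Ax F 2 θ.toStage13Params) gs → Step.InInterval γ₀ n gs →
        ∀ k, k ≤ n → -M ≤ ∑ j ∈ Finset.Ico k n, Node00.betaOfRecord₁₃Ax F 2 θ.toStage13Params j (prefixOf gs j)) ∧
      SurvCont (Node00.betaOfRecord₁₃Ax F 2 θ.toStage13Params) γ₀

/-- LINE 2 ⟹ LINE 2′ at rung 1 (kernel: drop the nodes ∕ the pin outside the window): every LINE-2 (hence every LINE-1) rung-1 result feeds LINE 2′. -/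
theorem nodesAtSomeRecord13PWSVW_of_V {F : T4Family} (hN : NodesAtSomeRecord13PWSV F) : NodesAtSomeRecord13PWSVW F := by
  obtain ⟨θ, h, v, w, hU, hθ, hR, hnodes, h08, lam, hsel, hstep⟩ := hN
  exact ⟨θ, h, v, w, hU, hθ, hR, fun P _ => hnodes P, h08, lam, hsel, fun P hk _ => hstep P hk⟩

/-- LINE 2 ⟹ LINE 2′ at rung 2. -/
theorem runRowsAtSomeRecord13PWSVW_of_V {F : T4Family} (hN : RunRowsAtSomeRecord13PWSV F) : RunRowsAtSomeRecord13PWSVW F := by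
  obtain ⟨θ, h, v, w, hU, hθ, hR, hnodes, b, r, γ₀, B, M, hγ₀, hrem, hB, hmatch, hps⟩ := hN
  exact ⟨θ, h, v, w, hU, hθ, hR, fun P _ => hnodes P, b, r, γ₀, B, M, hγ₀, hrem, hB, hmatch, hps⟩

/-- LINE 2 ⟹ LINE 2′ at rung 2‴. -/
theorem runRowsContAtSomeRecord13PWSVW_of_V {F : T4Family} (hN : RunRowsContAtSomeRecord13PWSV F) : RunRowsContAtSomeRecord13PWSVW F := by
  obtain ⟨θ, h, v, w, hU, hθ, hR, hnodes, b, r, γ₀, B, M, hγ₀, hrem, hB, hmatch, hps, hsc⟩ := hN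
  exact ⟨θ, h, v, w, hU, hθ, hR, fun P _ => hnodes P, b, r, γ₀, B, M, hγ₀, hrem, hB, hmatch, hps, hsc⟩

/-- LINE 1 ⟹ LINE 2′ at rung 1 (the `refl` door, then the window door). -/
theorem nodesAtSomeRecord13PWSVW_of_line1 {F : T4Family} (hN : NodesAtSomeRecord13PWS F) : NodesAtSomeRecord13PWSVW F :=
  nodesAtSomeRecord13PWSVW_of_V (nodesAtSomeRecord13PWSV_of_line1 hN)

/-- The ∀θ (C) letter `Cont13All` supplies stub 3ⱽ as it supplies LINE 1's stub 3 (kernel; witness kept, `γ₀` shrunk below `θ.γ` exactly as in `stubCont13_of_cont13All`). -/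
theorem stubCont13VW_of_cont13All (hC : Cont13All) : ∀ F : T4Family, RunRowsAtSomeRecord13PWSVW F → RunRowsContAtSomeRecord13PWSVW F := by
  intro F hrows
  obtain ⟨θ, h, v, w, hU, hθ, hR, hnodes, b, r, γ₀, B, M, hγ₀, hrem, hB, hmatch, hps⟩ := hrows
  obtain ⟨θ', h', hθ'adm, hD, hC', ⟨hwγ, hwγle⟩, hL, hup⟩ := hR
  have hγ₁ : 0 < min γ₀ w.γ := lt_min hγ₀ hwγ
  have hγ₁le : min γ₀ w.γ ≤ θ'.γ := (min_le_right _ _).trans hwγle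
  have hβ : Node00.betaOfRecord₁₃Ax F 2 θ'.toStage13Params = Node00.betaOfRecord₁₃Ax F 2 θ.toStage13Params := by
    rw [← Node00.βfun_datumOfRecord₁₃SepCoPHAx (θ := θ') (h := h'), ← Node00.βfun_datumOfRecord₁₃SepCoPHAx (θ := θ) (h := h), hD]
  have hsc : SurvCont (Node00.betaOfRecord₁₃Ax F 2 θ.toStage13Params) (min γ₀ w.γ) := by
    have := hC F θ' h' hθ'adm (min γ₀ w.γ) hγ₁ hγ₁le
    rwa [hβ] at this
  refine ⟨θ, h, v, w, hU, hθ, ⟨θ', h', hθ'adm, hD, hC', ⟨hwγ, hwγle⟩, hL, hup⟩, hnodes, b, r, min γ₀ w.γ, B, M, hγ₁, hrem.mono (min_le_left _ _), hB, hmatch, ?_, hsc⟩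
  intro n gs hrg hI k hk
  exact hps n gs hrg (fun j hj => ⟨(hI j hj).1, (hI j hj).2.trans (min_le_left _ _)⟩) k hk

end RunRows

end Summit.QuantumFields.YangMills.Theorems.K1AxV11Defs

end
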